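import Mathlib
import Summits.NavierStokesRegularity.NavierStokesRegularity.Theorems.TypeIQuarterGateQuarterZoomTypeIClock
import Summits.NavierStokesRegularity.NavierStokesRegularity.Theorems.NoBlowupToClay
import HarnessLib

/-!
# `TypeIQuarterGate`: links of the TYPE-I-CLOCK residual (TQAL) — by-name bookkeeping over
# `typeIQuarterGate_quarterZoom_typeIClock`

Helper file for the cruxes `QuarterLawTypeI` (stmt-NavierStokesRegularity-23726) and
`ParabolicGaldiLiouville` (stmt-NavierStokesRegularity-0893) of route `TypeIQuarterGate` (theorems
only, no definitions). TQAL ("Type-I-clock Liouville in Galdi's parabolic class", always spelled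
inline): every bounded ancient mild solution `v` (`ν = 1`), smooth on `(−∞,0) × ℝ³`, with uniformly
bounded slice enstrophy, `L⁶` slices and the Type-I clock `√(−s)‖v(s,y)‖ ≤ C'` (all `s < 0`, `y`),
vanishes identically.

* `typeIQuarterGate_of_typeIClockLiouville` — `QuarterLawTypeI → NoTypeII → TQAL →
  NavierStokesRegularity` (assembly as in `Theses.TypeIQuarterGate.closes`, with the Type-I-clock
  zoom in place of `QuarterZoom`): the route's residual X2 = `ParabolicGaldiLiouville` ⟨0893⟩ can be
  replaced by TQAL.
* `typeIClockLiouville_of_parabolicGaldiLiouville` — X2 ⟹ TQAL (drop the clock).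
* `typeIClockLiouville_of_typeIRateLiouville` — the bare Type-I-rate Liouville statement for bounded
  ancient mild solutions (KNSS / Seregin–Šverák form of Type-I exclusion) ⟹ TQAL.
* `typeIClockLiouville_steady_case` — a steady field obeying the clock is zero: Galdi's steady
  Liouville problem (item 0895), contained in X2, is NOT contained in TQAL.

HONEST FRAMING: TQAL is OPEN (of the same kind as the exclusion of Type-I blow-up); these are
implications between open statements; nothing here bears on Navier–Stokes regularity.
References: Koch–Nadirashvili–Seregin–Šverák, Acta Math. 203 (2009), §1 and §6.
-/

noncomputable section

set_option linter.dupNamespace false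

namespace Summit.NavierStokesRegularity.NavierStokesRegularity.Theorems

open Set MeasureTheory Filter Topology Function
open scoped ENNReal NNReal
open Literature.Analysis.FluidPDE

namespace QuarterZoomTypeIClock

/-- A time-independent quantity obeying the Type-I clock `√(−s)·‖v‖ ≤ C'` for all `s < 0` vanishes
(let `s → −∞`): steady flows are outside the Type-I-clock class. [folklore] -/
theorem eq_zero_of_steady_typeIClock {F : Type*} [NormedAddCommGroup F] {v : F} {C' : ℝ}
    (h : ∀ s : ℝ, s < 0 → Real.sqrt (-s) * ‖v‖ ≤ C') : v = 0 :=
  eq_zero_of_forall_lt_sqrt_neg_mul_norm_le (t := 0) (fun s hs => h s hs) le_rfl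

/-- Pointwise version for fields: a time-independent field `v₀` whose constant-in-time extension
obeys the Type-I clock at every point vanishes identically. [folklore] -/
theorem steady_eq_zero_of_typeIClock
    {v₀ : EuclideanSpace ℝ (Fin 3) → EuclideanSpace ℝ (Fin 3)} {C' : ℝ}
    (h : ∀ s : ℝ, s < 0 → ∀ y, Real.sqrt (-s) * ‖v₀ y‖ ≤ C') : v₀ = 0 := by
  funext y
  exact eq_zero_of_steady_typeIClock (fun s hs => h s hs y)

end QuarterZoomTypeIClock

open QuarterZoomTypeIClock

/-- **The route's Galdi back end can be replaced by a Type-I-clock Liouville statement.**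
`QuarterLawTypeI → NoTypeII → TQAL → NavierStokesRegularity`, where TQAL — "Type-I-clock Liouville
in Galdi's parabolic class", spelled inline — says: a bounded ancient mild solution (`ν = 1`), smooth
on `(−∞,0) × ℝ³`, with uniformly bounded slice enstrophy, `L⁶` slices AND the Type-I clock
`√(−s)‖v(s,y)‖ ≤ C'`, vanishes identically. Assembly as in `Theses.TypeIQuarterGate.closes`, with
`typeIQuarterGate_quarterZoom_typeIClock` in place of `QuarterZoom` and the in-tree reduction
`navierStokesRegularity_of_noBlowup`. TQAL is OPEN; this is a re-typing of the residual, not a proof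
of a crux. [cite: KochNadirashviliSereginSverak2009, §1 (Liouville conjectures) and §6] -/
theorem typeIQuarterGate_of_typeIClockLiouville
    (hQ : Summit.NavierStokesRegularity.NavierStokesRegularity.Theses.TypeIQuarterGate.QuarterLawTypeI)
    (hII : Summit.NavierStokesRegularity.NavierStokesRegularity.Theses.TypeIQuarterGate.NoTypeII)
    (hTQ : ∀ v : ℝ → EuclideanSpace ℝ (Fin 3) → EuclideanSpace ℝ (Fin 3),
      IsBoundedAncientMildSolution 1 v →
      ContDiffOn ℝ (⊤ : ℕ∞) (Function.uncurry v) (Set.Iio 0 ×ˢ Set.univ) →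
      (∃ C : NNReal, ∀ s < 0,
        ∫⁻ y, ENNReal.ofReal (frobeniusNormSq (fderiv ℝ (v s) y)) ≤ C) →
      (∀ s < 0, MemLp (v s) 6 volume) →
      (∃ C' : ℝ, 0 ≤ C' ∧ ∀ s < 0, ∀ y, Real.sqrt (-s) * ‖v s y‖ ≤ C') →
      ∀ s < 0, ∀ y, v s y = 0) :
    NavierStokesRegularity := by
  apply navierStokesRegularity_of_noBlowup
  intro ν T hν hT u p hcl hLH hdec
  by_contra hext
  obtain ⟨v, hv, hsm, hens, hL6, hne, hclock⟩ :=
    typeIQuarterGate_quarterZoom_typeIClock hII hQ ν T hν hT u p hcl hLH hdec hext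
  exact hne (hTQ v hv hsm ⟨1, fun s hs => le_of_le_of_eq (hens s hs) ENNReal.coe_one.symm⟩ hL6
    hclock)

/-- X2 = `ParabolicGaldiLiouville` ⟹ TQAL: the declared residual implies the re-typed one (drop the
clock hypothesis). [folklore] -/
theorem typeIClockLiouville_of_parabolicGaldiLiouville
    (hP : Summit.NavierStokesRegularity.NavierStokesRegularity.Theses.TypeIQuarterGate.ParabolicGaldiLiouville) :
    ∀ v : ℝ → EuclideanSpace ℝ (Fin 3) → EuclideanSpace ℝ (Fin 3),
      IsBoundedAncientMildSolution 1 v →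
      ContDiffOn ℝ (⊤ : ℕ∞) (Function.uncurry v) (Set.Iio 0 ×ˢ Set.univ) →
      (∃ C : NNReal, ∀ s < 0,
        ∫⁻ y, ENNReal.ofReal (frobeniusNormSq (fderiv ℝ (v s) y)) ≤ C) →
      (∀ s < 0, MemLp (v s) 6 volume) →
      (∃ C' : ℝ, 0 ≤ C' ∧ ∀ s < 0, ∀ y, Real.sqrt (-s) * ‖v s y‖ ≤ C') →
      ∀ s < 0, ∀ y, v s y = 0 :=
  fun v hv hsm hens hL6 _ => hP v hv hsm hens hL6

/-- The bare Type-I-rate Liouville statement for bounded ancient mild solutions (KNSS / Seregin–Šverák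
form of Type-I exclusion: a bounded ancient mild solution with `√(−s)‖v(s,y)‖ ≤ C'` is `≡ 0`) ⟹ TQAL
(drop enstrophy, `L⁶` and smoothness). [cite: KochNadirashviliSereginSverak2009, §1] -/
theorem typeIClockLiouville_of_typeIRateLiouville
    (hL : ∀ v : ℝ → EuclideanSpace ℝ (Fin 3) → EuclideanSpace ℝ (Fin 3),
      IsBoundedAncientMildSolution 1 v →
      (∃ C' : ℝ, 0 ≤ C' ∧ ∀ s < 0, ∀ y, Real.sqrt (-s) * ‖v s y‖ ≤ C') →
      ∀ s < 0, ∀ y, v s y = 0) :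
    ∀ v : ℝ → EuclideanSpace ℝ (Fin 3) → EuclideanSpace ℝ (Fin 3),
      IsBoundedAncientMildSolution 1 v →
      ContDiffOn ℝ (⊤ : ℕ∞) (Function.uncurry v) (Set.Iio 0 ×ˢ Set.univ) →
      (∃ C : NNReal, ∀ s < 0,
        ∫⁻ y, ENNReal.ofReal (frobeniusNormSq (fderiv ℝ (v s) y)) ≤ C) →
      (∀ s < 0, MemLp (v s) 6 volume) →
      (∃ C' : ℝ, 0 ≤ C' ∧ ∀ s < 0, ∀ y, Real.sqrt (-s) * ‖v s y‖ ≤ C') →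
      ∀ s < 0, ∀ y, v s y = 0 :=
  fun v hv _ _ _ hclock => hL v hv hclock

/-- **Galdi's steady problem is outside the re-typed residual.** A time-independent field in the
TQAL class is zero already by the clock: for `v s = v₀` (all `s < 0`) with `√(−s)‖v₀ y‖ ≤ C'` for all
`s < 0`, `y`, one has `v₀ = 0` — whereas X2 restricted to steady fields is Galdi's open Liouville
problem for `D`-solutions (item 0895). [folklore] -/
theorem typeIClockLiouville_steady_case
    (v₀ : EuclideanSpace ℝ (Fin 3) → EuclideanSpace ℝ (Fin 3))
    (hclock : ∃ C' : ℝ, 0 ≤ C' ∧ ∀ s : ℝ, s < 0 → ∀ y, Real.sqrt (-s) * ‖v₀ y‖ ≤ C') :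
    ∀ s : ℝ, s < 0 → ∀ y, (fun _ : ℝ => v₀) s y = 0 := by
  obtain ⟨C', -, h⟩ := hclock
  have h0 : v₀ = 0 := steady_eq_zero_of_typeIClock h
  intro s _ y
  simp [h0]


end Summit.NavierStokesRegularity.NavierStokesRegularity.Theorems

end
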